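import Mathlib
import HarnessLib

/-!
# Kneser's addition theorem and the stabilizer (period) of a finite set

Topic: `Literature/Combinatorics/Additive`.  Cell `mm-stpp` (D-0046), seat `mm-stpp-lit`: Kneser's theorem is
the one tool of the cell's hand exclusions (rules U11-K, U11-Δ⁺, the planner's (‡) step and eng-2's
near-period case splits, `HOME/mm-stpp-lit/KNESER-KILLS.md`) that neither Mathlib (pinned) nor
`Literature` had: Mathlib stops at Cauchy–Davenport/DeVos (`Finset.cauchy_davenport_minOrder_mul`),
the e-transform and the Dyson transform and Freiman's `3/2` theorem; `Literature` has the LINEAR (Hou–Leung–Xiang)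
version `Literature.Combinatorics.Additive.LinearKneser_holds` only.

**Theorem (Kneser 1953).**  Let `A, B` be finite non-empty subsets of an abelian group `G` and
`H := {g ∈ G | g + A + B = A + B}` the stabilizer (group of periods) of `A + B`.  Then
`|A + B| ≥ |A + H| + |B + H| − |H|`; in particular `|A + B| ≥ |A| + |B| − |H|`
[cite: Kneser1953] · [DeVos2014, Thm 1] · [Nathanson1996, Thm 4.3 (§4.2), Thm 4.2 for the case
`|A + B| < |A| + |B|`] · [TaoVu2006, Thm 5.5].

## Contents

* Part I (`namespace Finset`, a deliberate dot-notation extension of Mathlib's namespace, stated so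
  in each docstring's source): `Finset.mulStab s` / `Finset.addStab s` — the stabilizer of a finset
  AS A FINSET (`∅ ↦ ∅`), with its API: membership, `coe_mulStab` (= `MulAction.stabilizer`),
  idempotence, translation invariance, coset disjointness, the divisibilities
  `#s.mulStab ∣ #s`, `#t.mulStab ∣ #(s * t.mulStab)`, `#s.mulStab ∣ Fintype.card α`, and three
  Lagrange-type cardinality identities through the quotient `α ⧸ stabilizer α ↑s`.
* Part II (`namespace Literature.Combinatorics.Additive`): `mul_kneser` / `add_kneser` (the theorem),
  `mul_strict_kneser` / `add_strict_kneser` (divisibility refinement), and the weak form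
  `card_add_card_le_card_mul_add_card_mulStab` / `card_add_card_le_card_add_add_card_addStab`
  (`#s + #t ≤ #(s * t) + #(s * t).mulStab`, Tao–Vu Thm 5.5 second inequality), which is the
  shape the STPP census uses (`|X + Y| ≥ |X| + |Y| − |Stab(X + Y)|`).

## Proof followed

DeVos's short proof [cite: DeVos2014, Thm 1], step for step (see the docstring of `mul_kneser` and
the private lemmas `mulStab_mul_ssubset_mulStab`, `mulStab_union`, `mul_aux1` = inequality (1),
`disjoint_mul_sub_card_le` / `inter_mul_sub_card_le` = the two degenerate-case counts,
`card_mul_add_card_lt` = the induction measure).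

## Lean source and licence

Parts I–II are a port of `MiscYD/AddCombi/Kneser/MulStab.lean` and `…/Kneser/Kneser.lean`
(Copyright (c) 2023 Mantas Bakšys, Yaël Dillies; released under the Apache 2.0 licence; authors
Mantas Bakšys, Yaël Dillies — originally in LeanCamCombi), fetched 2026-08-25 from
`github.com/YaelDillies/MiscYD` (toolchain `v4.34.0-rc2`) and adapted to the pinned Mathlib of this
tree: one lemma name (`Set.mem_ofPred_eq` ↦ `Set.mem_setOf_eq`), the `module`/`public import`
header replaced by `import Mathlib`, the Kneser-specific auxiliaries made `private` and moved to the
topic namespace, docstrings/provenance tags added, two `KneserRuzsa`-only lemmas dropped, and the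
corollaries `card_add_card_le_card_mul_add_card_mulStab`, `Finset.card_mulStab_dvd_card_univ` added.
When Mathlib acquires `Finset.mulStab` / `Finset.mul_kneser`, Part I and `mul_kneser` should be
deleted in favour of the Mathlib declarations (same names and statements by design).

## References
* M. Kneser, *Abschätzung der asymptotischen Dichte von Summenmengen*, Math. Z. 58 (1953) 459–484
  [cite: Kneser1953] — the original (the abelian-group theorem; attribution as in Nathanson's notes
  to Ch. 4 and in DeVos).
* M. DeVos, *A short proof of Kneser's addition theorem for abelian groups*, in: Combinatorial and
  Additive Number Theory (CANT 2011–12), Springer PROMS 101 (2014) 39–41, arXiv:1303.3539 — Thm 1 and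
  its proof, followed here verbatim [cite: DeVos2014, Thm 1] (held: `paper:arxiv-1303.3539`).
* M. B. Nathanson, *Additive Number Theory: Inverse Problems and the Geometry of Sumsets*, GTM 165
  (1996), Ch. 4 "Kneser's theorem for groups": Thm 4.2 (equality when `|A+B| < |A|+|B|`), Thm 4.3
  (the inequality) [cite: Nathanson1996, Thm 4.3].
* T. Tao, V. Vu, *Additive Combinatorics*, CUP (2006), Thm 5.5 (both inequalities, `Sym₁(A+B)`)
  [cite: TaoVu2006, Thm 5.5].
-/

open Function MulAction
open scoped Pointwise

/-! ## Part I — the stabilizer of a finset, as a finset (`Finset.mulStab` / `Finset.addStab`)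

Deliberate dot-notation extension of Mathlib's `Finset` namespace (so that `s.mulStab`,
`(s * t).mulStab` read as in the upstream source); see the module docstring. -/

namespace Finset
variable {ι α : Type*}


local notation s " +ₛ " N => Finset.image ((↑) : α → α ⧸ N) s
local notation s " +ˢ " N => Set.image ((↑) : α → α ⧸ N) s

section Group
variable [Group α] [DecidableEq α] {s t : Finset α} {a : α}

/-- Membership in the set-stabilizer `MulAction.stabilizer α ↑s` of a finset is decidable. [folklore] -/
@[to_additive]
instance (s : Finset α) : DecidablePred (· ∈ stabilizer α (s : Set α)) :=
  fun a ↦ decidable_of_iff (a ∈ stabilizer α s) (by simp)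

/-- The stabilizer (group of periods) `{a | a • s = s}` of a finset `s`, as a finset; as an
exception, this sends `∅` to `∅`.  Deliberate dot-notation extension of Mathlib's `Finset`
namespace (port of the Bakšys–Dillies `Finset.mulStab` API, see the module docstring). [cite: Nathanson1996, §4.1] -/
@[to_additive /-- The stabilizer (group of periods) of a finset `s`, as a finset; as an exception,
this sends `∅` to `∅`.  Deliberate dot-notation extension of Mathlib's `Finset` namespace. -/]
def mulStab (s : Finset α) : Finset α := {a ∈ s / s | a • s = s}

/-- For a nonempty finset `s`: `a ∈ s.mulStab ↔ a • s = s`. [cite: Nathanson1996, §4.1] -/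
@[to_additive (attr := simp)]
lemma mem_mulStab (hs : s.Nonempty) : a ∈ s.mulStab ↔ a • s = s := by
  rw [mulStab, mem_filter, mem_div, and_iff_right_of_imp]
  obtain ⟨b, hb⟩ := hs
  exact fun h ↦ ⟨_, by rw [← h]; exact smul_mem_smul_finset hb, _, hb, mul_div_cancel_right _ _⟩

/-- `s.mulStab ⊆ s / s`. [cite: Nathanson1996, §4.1] -/
@[to_additive]
lemma mulStab_subset_div : s.mulStab ⊆ s / s := filter_subset _ _

/-- `s.mulStab ⊆ s / {a}` whenever `a ∈ s`. [cite: Nathanson1996, §4.1] -/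
@[to_additive]
lemma mulStab_subset_div_right (ha : a ∈ s) : s.mulStab ⊆ s / {a} := by
  refine fun b hb ↦ mem_div.2 ⟨_, ?_, _, mem_singleton_self _, mul_div_cancel_right _ _⟩
  rw [mem_mulStab ⟨a, ha⟩] at hb
  rw [← hb]
  exact smul_mem_smul_finset ha

/-- For nonempty `s`, the coercion of `s.mulStab` to a set is `MulAction.stabilizer α ↑s`. [cite: Nathanson1996, §4.1] -/
@[to_additive (attr := simp)]
lemma coe_mulStab (hs : s.Nonempty) : (s.mulStab : Set α) = stabilizer α (s : Set α) := by
  ext; simp [mem_mulStab hs]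

/-- `a ∈ s.mulStab ↔ s ⊆ a • s` (for nonempty `s`). [cite: Nathanson1996, §4.1] -/
@[to_additive]
lemma mem_mulStab_iff_subset_smul_finset (hs : s.Nonempty) : a ∈ s.mulStab ↔ s ⊆ a • s := by
  rw [← mem_coe, coe_mulStab hs, SetLike.mem_coe, stabilizer_coe_finset,
    mem_stabilizer_finset_iff_subset_smul_finset]

/-- `a ∈ s.mulStab ↔ a • s ⊆ s` (for nonempty `s`). [cite: Nathanson1996, §4.1] -/
@[to_additive]
lemma mem_mulStab_iff_smul_finset_subset (hs : s.Nonempty) : a ∈ s.mulStab ↔ a • s ⊆ s := by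
  rw [← mem_coe, coe_mulStab hs, SetLike.mem_coe, stabilizer_coe_finset,
    mem_stabilizer_finset_iff_smul_finset_subset]

/-- `a ∈ s.mulStab ↔ ∀ b ∈ s, a • b ∈ s` (for nonempty `s`). [cite: Nathanson1996, §4.1] -/
@[to_additive]
lemma mem_mulStab' (hs : s.Nonempty) : a ∈ s.mulStab ↔ ∀ ⦃b⦄, b ∈ s → a • b ∈ s := by
  rw [← mem_coe, coe_mulStab hs, SetLike.mem_coe, stabilizer_coe_finset, mem_stabilizer_finset']

/-- `(∅ : Finset α).mulStab = ∅` (the convention for the empty set). [cite: Nathanson1996, §4.1] -/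
@[to_additive (attr := simp)]
lemma mulStab_empty : mulStab (∅ : Finset α) = ∅ := by simp [mulStab]

/-- The stabilizer of a singleton is trivial: `({a} : Finset α).mulStab = 1`. [cite: Nathanson1996, §4.1] -/
@[to_additive (attr := simp)]
lemma mulStab_singleton (a : α) : mulStab ({a} : Finset α) = 1 := by
  simp [mulStab, singleton_one, filter_true_of_mem]

/-- If `s.mulStab` is nonempty then so is `s`. [cite: Nathanson1996, §4.1] -/
@[to_additive]
lemma Nonempty.of_mulStab : s.mulStab.Nonempty → s.Nonempty := by
  simp_rw [nonempty_iff_ne_empty, not_imp_not]; rintro rfl; exact mulStab_empty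

/-- `1 ∈ s.mulStab ↔ s.Nonempty`. [cite: Nathanson1996, §4.1] -/
@[to_additive (attr := simp)]
lemma one_mem_mulStab : (1 : α) ∈ s.mulStab ↔ s.Nonempty :=
  ⟨fun h ↦ Nonempty.of_mulStab ⟨_, h⟩, fun h ↦ (mem_mulStab h).2 <| one_smul _ _⟩

@[to_additive] protected alias ⟨_, Nonempty.one_mem_mulStab⟩ := one_mem_mulStab

/-- The stabilizer of a nonempty finset is nonempty (it contains `1`). [cite: Nathanson1996, §4.1] -/
@[to_additive]
lemma Nonempty.mulStab (h : s.Nonempty) : s.mulStab.Nonempty := ⟨_, h.one_mem_mulStab⟩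

/-- `s.mulStab.Nonempty ↔ s.Nonempty`. [cite: Nathanson1996, §4.1] -/
@[to_additive (attr := simp)]
lemma mulStab_nonempty : s.mulStab.Nonempty ↔ s.Nonempty := ⟨Nonempty.of_mulStab, Nonempty.mulStab⟩

/-- `#s.mulStab = 1 ↔ s.mulStab = 1`. [cite: Nathanson1996, §4.1] -/
@[to_additive (attr := simp)]
lemma card_mulStab_eq_one : #s.mulStab = 1 ↔ s.mulStab = 1 := by
  refine ⟨fun h ↦ ?_, fun h ↦ by rw [h, card_one]⟩
  obtain ⟨a, ha⟩ := card_eq_one.1 h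
  rw [ha]
  rw [eq_singleton_iff_nonempty_unique_mem, mulStab_nonempty, ← one_mem_mulStab] at ha
  rw [← ha.2 _ ha.1, singleton_one]

/-- For nonempty `s`, the stabilizer is nontrivial as a finset iff it is not the trivial subgroup `1`. [cite: Nathanson1996, §4.1] -/
@[to_additive]
lemma Nonempty.mulStab_nontrivial (h : s.Nonempty) : s.mulStab.Nontrivial ↔ s.mulStab ≠ 1 :=
  nontrivial_iff_ne_singleton h.one_mem_mulStab

/-- `s.mulStab ⊆ (s * t).mulStab` for nonempty `t`: periods of `s` are periods of `s * t`. [cite: Nathanson1996, §4.1] -/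
@[to_additive]
lemma subset_mulStab_mul_left (ht : t.Nonempty) : s.mulStab ⊆ (s * t).mulStab := by
  obtain rfl | hs := s.eq_empty_or_nonempty
  · simp
  simp_rw [subset_iff, mem_mulStab hs, mem_mulStab (hs.mul ht)]
  rintro a h
  rw [← smul_mul_assoc, h]

/-- `s.mulStab * s = s`. [cite: Nathanson1996, §4.1] -/
@[to_additive (attr := simp)]
lemma mulStab_mul (s : Finset α) : s.mulStab * s = s := by
  obtain rfl | hs := s.eq_empty_or_nonempty
  · exact mul_empty _
  · simp only [← coe_inj, hs, coe_mul, coe_mulStab, stabilizer_mul_self]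

/-- `s * t ⊆ t ↔ s ⊆ t.mulStab` (for nonempty `t`). [cite: Nathanson1996, §4.1] -/
@[to_additive]
lemma mul_subset_right_iff (ht : t.Nonempty) : s * t ⊆ t ↔ s ⊆ t.mulStab := by
  simp_rw [← smul_eq_mul, ← biUnion_smul_finset, biUnion_subset,
    ← mem_mulStab_iff_smul_finset_subset ht, subset_iff]

/-- `s ⊆ t.mulStab → s * t ⊆ t`. [cite: Nathanson1996, §4.1] -/
@[to_additive]
lemma mul_subset_right : s ⊆ t.mulStab → s * t ⊆ t := by
  obtain rfl | ht := t.eq_empty_or_nonempty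
  · simp
  · exact (mul_subset_right_iff ht).2

/-- `a • s.mulStab = s.mulStab` for `a ∈ s.mulStab` (the stabilizer is a subgroup). [cite: Nathanson1996, §4.1] -/
@[to_additive]
lemma smul_mulStab (ha : a ∈ s.mulStab) : a • s.mulStab = s.mulStab := by
  obtain rfl | hs := s.eq_empty_or_nonempty
  · simp
  rw [← mem_coe, coe_mulStab hs, SetLike.mem_coe] at ha
  rw [← coe_inj, coe_smul_finset, coe_mulStab hs, smul_coe_set ha]

/-- `s.mulStab * s.mulStab = s.mulStab` (the stabilizer is closed under multiplication). [cite: Nathanson1996, §4.1] -/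
@[to_additive (attr := simp)]
lemma mulStab_mul_mulStab (s : Finset α) : s.mulStab * s.mulStab = s.mulStab := by
  obtain rfl | hs := s.eq_empty_or_nonempty
  · simp
  · simp_rw [← smul_eq_mul, ← biUnion_smul_finset, biUnion_congr rfl fun _ ↦ smul_mulStab,
      ← sup_eq_biUnion, sup_const hs.mulStab]

/-- `s.mulStab ∩ t.mulStab ⊆ (s ∪ t).mulStab`. [cite: Nathanson1996, §4.1] -/
@[to_additive]
lemma inter_mulStab_subset_mulStab_union : s.mulStab ∩ t.mulStab ⊆ (s ∪ t).mulStab := by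
  obtain rfl | hs := s.eq_empty_or_nonempty
  · simp
  obtain rfl | ht := t.eq_empty_or_nonempty
  · simp
  intro x hx
  rw [mem_mulStab (hs.mono subset_union_left), smul_finset_union,
    (mem_mulStab hs).mp (mem_of_mem_inter_left hx),
    (mem_mulStab ht).mp (mem_of_mem_inter_right hx)]

end Group

variable [CommGroup α] [DecidableEq α] {s t : Finset α} {a : α}

/-- `s.mulStab ⊆ {a} / s` whenever `a ∈ s` (commutative group). [cite: Nathanson1996, §4.1] -/
@[to_additive]
lemma mulStab_subset_div_left (ha : a ∈ s) : s.mulStab ⊆ {a} / s := by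
  refine fun b hb ↦ mem_div.2 ⟨_, mem_singleton_self _, _, ?_, div_div_cancel _ _⟩
  rw [mem_mulStab ⟨a, ha⟩] at hb
  rwa [← hb, ← inv_smul_mem_iff, smul_eq_mul, inv_mul_eq_div] at ha

/-- `t.mulStab ⊆ (s * t).mulStab` for nonempty `s`. [cite: Nathanson1996, §4.1] -/
@[to_additive]
lemma subset_mulStab_mul_right (hs : s.Nonempty) : t.mulStab ⊆ (s * t).mulStab := by
  rw [mul_comm]; exact subset_mulStab_mul_left hs

/-- `s * s.mulStab = s`. [cite: Nathanson1996, §4.1] -/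
@[to_additive (attr := simp)]
lemma mul_mulStab (s : Finset α) : s * s.mulStab = s := by rw [mul_comm]; exact mulStab_mul _

/-- `(s * H) * (t * H) = s * t` for `H = (s * t).mulStab`. [cite: Nathanson1996, §4.1] -/
@[to_additive (attr := simp)]
lemma mul_mulStab_mul_mul_mul_mulStab_mul :
    s * (s * t).mulStab * (t * (s * t).mulStab) = s * t := by
  rw [mul_mul_mul_comm, mulStab_mul_mulStab, mul_mulStab]

/-- `a • s.mulStab ⊆ s` for `a ∈ s`: `s` is a union of cosets of its stabilizer. [cite: Nathanson1996, §4.1] -/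
@[to_additive]
lemma smul_finset_mulStab_subset (ha : a ∈ s) : a • s.mulStab ⊆ s :=
  (smul_finset_subset_smul ha).trans s.mul_mulStab.subset

/-- `s * t ⊆ s ↔ t ⊆ s.mulStab` (for nonempty `s`). [cite: Nathanson1996, §4.1] -/
@[to_additive]
lemma mul_subset_left_iff (hs : s.Nonempty) : s * t ⊆ s ↔ t ⊆ s.mulStab := by
  rw [mul_comm, mul_subset_right_iff hs]

/-- `t ⊆ s.mulStab → s * t ⊆ s`. [cite: Nathanson1996, §4.1] -/
@[to_additive]
lemma mul_subset_left : t ⊆ s.mulStab → s * t ⊆ s := by rw [mul_comm]; exact mul_subset_right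

/-- `s.mulStab.mulStab = s.mulStab`. [cite: Nathanson1996, §4.1] -/
@[to_additive (attr := simp)]
lemma mulStab_idem (s : Finset α) : s.mulStab.mulStab = s.mulStab := by
  obtain rfl | hs := s.eq_empty_or_nonempty
  · simp
  rw [← coe_inj, coe_mulStab hs, coe_mulStab hs.mulStab, coe_mulStab hs]
  simp

/-- Translation does not change the stabilizer: `(a • s).mulStab = s.mulStab`. [cite: Nathanson1996, §4.1] -/
@[to_additive (attr := simp)]
lemma mulStab_smul (a : α) (s : Finset α) : (a • s).mulStab = s.mulStab := by
  obtain rfl | hs := s.eq_empty_or_nonempty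
  · simp
  · rw [← coe_inj, coe_mulStab hs, coe_mulStab hs.smul_finset, stabilizer_coe_finset,
    stabilizer_coe_finset, stabilizer_smul_eq_right]

/-- The image of a nonempty `s` in the quotient `α ⧸ stabilizer α ↑s` has trivial stabilizer. [cite: DeVos2014, proof of Thm 1] -/
@[to_additive]
lemma mulStab_image_coe_quotient (hs : s.Nonempty) :
    (s.image (↑) : Finset (α ⧸ stabilizer α (s : Set α))).mulStab = 1 := by
  simp_rw [← coe_inj, coe_mulStab (hs.image _), coe_image, coe_one]
  rw [stabilizer_image_coe_quotient, Subgroup.coe_bot, Set.singleton_one]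

/-- The preimage of the image of `s` in `α ⧸ stabilizer α ↑t` is `s * t.mulStab` (for nonempty `t`). [cite: DeVos2014, proof of Thm 1] -/
@[to_additive]
lemma preimage_image_quotientMk_stabilizer_eq_mul_mulStab (ht : t.Nonempty) (s : Finset α) :
    QuotientGroup.mk ⁻¹' (s +ˢ stabilizer α (t : Set α)) = s * t.mulStab := by
  rw [QuotientGroup.preimage_image_mk_eq_mul, coe_mulStab ht, stabilizer_coe_finset]

omit [DecidableEq α] in
/-- The preimage of the image of `s` in `α ⧸ stabilizer α ↑s` is `s` itself. [cite: DeVos2014, proof of Thm 1] -/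
@[to_additive]
lemma preimage_image_quotientMk_mulStabilizer (s : Finset α) :
    QuotientGroup.mk ⁻¹' (s +ˢ stabilizer α (s : Set α)) = s := by
  classical
  obtain rfl | hs := s.eq_empty_or_nonempty
  · simp
  · rw [preimage_image_quotientMk_stabilizer_eq_mul_mulStab hs s, ← coe_mul, mul_mulStab]

/-- The cosets `a • s.mulStab` of the stabilizer are pairwise disjoint. [cite: Nathanson1996, §4.1] -/
@[to_additive]
lemma pairwiseDisjoint_smul_finset_mulStab (s : Finset α) :
    (Set.range fun a : α ↦ a • s.mulStab).PairwiseDisjoint id := by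
  obtain rfl | hs := s.eq_empty_or_nonempty
  · simp
  rintro _ ⟨a, rfl⟩ _ ⟨b, rfl⟩
  simp only [onFun, id_eq]
  simp_rw [← disjoint_coe, ← coe_injective.ne_iff, coe_smul_finset, coe_mulStab hs]
  exact fun h ↦ isBlock_subgroup h

/-- A coset `a • s.mulStab` not contained in the `s.mulStab`-periodic set `t * s.mulStab` is disjoint from it. [cite: Nathanson1996, §4.1] -/
@[to_additive]
lemma disjoint_smul_finset_mulStab_mul_mulStab :
    ¬a • s.mulStab ⊆ t * s.mulStab → Disjoint (a • s.mulStab) (t * s.mulStab) := by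
  simp_rw [@not_imp_comm (_ ≤ _), ← smul_eq_mul, ← biUnion_smul_finset, disjoint_biUnion_right,
    Classical.not_forall]
  rintro ⟨b, hb, h⟩
  rw [s.pairwiseDisjoint_smul_finset_mulStab.eq (Set.mem_range_self _) (Set.mem_range_self _) h]
  exact subset_biUnion_of_mem (· • mulStab s) hb

/-- `#t.mulStab ∣ #(s * t.mulStab)`: an `H`-periodic set is a disjoint union of `H`-cosets. [cite: Nathanson1996, §4.1] -/
@[to_additive]
lemma card_mulStab_dvd_card_mul_mulStab (s t : Finset α) : #t.mulStab ∣ #(s * t.mulStab) :=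
  card_dvd_card_smul_right <|
    t.pairwiseDisjoint_smul_finset_mulStab.subset <| Set.image_subset_range _ _

/-- `#s.mulStab ∣ #s`: a finset is a disjoint union of cosets of its stabilizer. [cite: Nathanson1996, §4.1] -/
@[to_additive]
lemma card_mulStab_dvd_card (s : Finset α) : #s.mulStab ∣ #s := by
  simpa only [mul_mulStab] using s.card_mulStab_dvd_card_mul_mulStab s

/-- `#s.mulStab ≤ #s`. [cite: Nathanson1996, §4.1] -/
@[to_additive]
lemma card_mulStab_le_card : #s.mulStab ≤ #s := by
  obtain rfl | hs := s.eq_empty_or_nonempty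
  · rfl
  · exact Nat.le_of_dvd hs.card_pos s.card_mulStab_dvd_card

/-- A fintype instance for the stabilizer of a nonempty finset `s` in terms of `s.mulStab`. [folklore] -/
@[to_additive (attr := implicit_reducible)
/-- A fintype instance for the stabilizer of a nonempty finset `s` in terms of `s.addStab`. -/]
private def fintypeStabilizerOfMulStab (hs : s.Nonempty) : Fintype (stabilizer α s) where
  elems := s.mulStab.attach.map
    ⟨Subtype.map id fun _ ↦ (mem_mulStab hs).1, Subtype.map_injective _ injective_id⟩
  complete a := mem_map.2
    ⟨⟨_, (mem_mulStab hs).2 a.2⟩, mem_attach _ ⟨_, (mem_mulStab hs).2 a.2⟩, Subtype.ext rfl⟩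

/-- Lagrange for stabilizers: if `s` is nonempty and `s.mulStab ⊆ t.mulStab` then `#s.mulStab ∣ #t.mulStab`. [cite: Nathanson1996, §4.1] -/
@[to_additive]
lemma card_mulStab_dvd_card_mulStab (hs : s.Nonempty) (h : s.mulStab ⊆ t.mulStab) :
    #s.mulStab ∣ #t.mulStab := by
  obtain rfl | ht := t.eq_empty_or_nonempty
  · simp
  rw [← coe_subset, coe_mulStab hs, coe_mulStab ht, SetLike.coe_subset_coe] at h
  let : Fintype (stabilizer α s) := fintypeStabilizerOfMulStab hs
  let : Fintype (stabilizer α t) := fintypeStabilizerOfMulStab ht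
  convert Subgroup.card_dvd_of_le h using 1
  · simp only [stabilizer_coe_finset, Nat.card_eq_fintype_card]
    change _ = #(s.mulStab.attach.map
    ⟨Subtype.map id fun _ ↦ (mem_mulStab hs).1, Subtype.map_injective _ injective_id⟩)
    simp
  · simp only [stabilizer_coe_finset, Nat.card_eq_fintype_card]
    change _ = #(t.mulStab.attach.map
      ⟨Subtype.map id fun _ ↦ (mem_mulStab ht).1, Subtype.map_injective _ injective_id⟩)
    simp

/-- A version of Lagrange's theorem: `#t.mulStab * #(image of s in α ⧸ stabilizer α ↑t) = #(s * t.mulStab)`. [cite: DeVos2014, proof of Thm 1] -/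
@[to_additive /-- A version of Lagrange's theorem. -/]
lemma card_mulStab_mul_card_image_coe' (s t : Finset α)
    [DecidableEq (α ⧸ stabilizer α (t : Set α))] :
    #t.mulStab * #(s +ₛ stabilizer α (t : Set α)) = #(s * t.mulStab) := by
  obtain rfl | ht := t.eq_empty_or_nonempty
  · simp
  have := QuotientGroup.preimageMkEquivSubgroupProdSet _ (s +ˢ stabilizer α (t : Set α))
  have that : ↥(stabilizer α (t : Set α)) = ↥t.mulStab := by
    rw [← SetLike.coe_sort_coe, ← coe_mulStab ht, Finset.coe_sort_coe]
  have temp := this.trans ((Equiv.cast that).prodCongr (Equiv.refl _))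
  rw [preimage_image_quotientMk_stabilizer_eq_mul_mulStab ht] at temp
  simpa only [coe_sort_coe, ← coe_mul, Fintype.card_prod, Fintype.card_coe, Fintype.card_ofFinset,
    toFinset_coe, mem_image, Set.mem_image, mem_coe, forall_const, eq_comm]
    using Fintype.card_congr temp

/-- `#(s * t) = #(s * t).mulStab * #(image of s * t in α ⧸ stabilizer α ↑(s * t))` — a version of Lagrange's theorem. [cite: DeVos2014, proof of Thm 1] -/
@[to_additive]
lemma card_mul_card_eq_mulStab_card_mul_coe (s t : Finset α) :
    #(s * t) = #(s * t).mulStab * #((s * t) +ₛ stabilizer α (↑(s * t) : Set α)) := by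
  obtain rfl | hs := s.eq_empty_or_nonempty
  · simp
  obtain rfl | ht := t.eq_empty_or_nonempty
  · simp
  have := QuotientGroup.preimageMkEquivSubgroupProdSet _ <|
    ↑(s * t) +ˢ stabilizer α (↑(s * t) : Set α)
  have that : ↥(stabilizer α (↑(s * t) : Set α)) = ↥(s * t).mulStab := by
    rw [← SetLike.coe_sort_coe, ← coe_mulStab (hs.mul ht), Finset.coe_sort_coe]
  have temp := this.trans <| (Equiv.cast that).prodCongr (Equiv.refl _)
  rw [preimage_image_quotientMk_mulStabilizer] at temp
  simpa [-coe_mul] using Fintype.card_congr temp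

/-- A version of Lagrange's theorem: `#(s * t).mulStab * #(s̄ * t̄) = #(s * t)`, bars denoting images in
`α ⧸ stabilizer α ↑(s * t)`. [cite: DeVos2014, proof of Thm 1] -/
@[to_additive /-- A version of Lagrange's theorem. -/]
lemma card_mulStab_mul_card_image_coe (s t : Finset α) :
    #(s * t).mulStab *
      #((s +ₛ stabilizer α (↑(s * t) : Set α)) * (t +ₛ stabilizer α (↑(s * t) : Set α))) =
        #(s * t) := by
  obtain rfl | hs := s.eq_empty_or_nonempty
  · simp
  obtain rfl | ht := t.eq_empty_or_nonempty
  · simp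
  let this := QuotientGroup.preimageMkEquivSubgroupProdSet (stabilizer α (↑(s * t) : Set α))
    ((s +ˢ stabilizer α (↑(s * t) : Set α)) * (t +ˢ stabilizer α (↑(s * t) : Set α)))
  have image_coe_mul :
    ((↑(s * t) : Set α) +ˢ stabilizer α (↑(s * t) : Set α)) =
      (s +ˢ stabilizer α (↑(s * t) : Set α)) * (t +ˢ stabilizer α (↑(s * t) : Set α)) := by
    simpa [coe_mul] using Set.image_mul (QuotientGroup.mk' (stabilizer α (↑(s * t) : Set α)))
  rw [← image_coe_mul, preimage_image_quotientMk_mulStabilizer, image_coe_mul] at this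
  have that :
    (stabilizer α (↑(s * t) : Set α) ×
      ↥((s +ˢ stabilizer α (↑(s * t) : Set α)) * (t +ˢ stabilizer α (↑(s * t) : Set α)))) =
      ((s * t).mulStab ×
        ↥((s +ˢ stabilizer α (↑(s * t) : Set α)) * (t +ˢ stabilizer α (↑(s * t) : Set α)))) := by
    rw [← SetLike.coe_sort_coe, ← coe_mulStab (hs.mul ht), Finset.coe_sort_coe]
  let temp := this.trans (Equiv.cast that)
  replace temp := Fintype.card_congr temp
  simp only [Fintype.card_prod, Fintype.card_coe] at temp
  have h1 : Fintype.card ((s * t : Finset α) : Set α) = Fintype.card (s * t) := by congr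
  have h2 : (s +ˢ stabilizer α (↑(s * t) : Set α)) * (t +ˢ stabilizer α (↑(s * t) : Set α)) =
    ↑((s +ₛ stabilizer α (↑(s * t) : Set α)) * (t +ₛ stabilizer α (↑(s * t) : Set α))) := by simp
  have h3 :
    Fintype.card ((s +ˢ stabilizer α (↑(s * t) : Set α)) * (t +ˢ stabilizer α (↑(s * t) : Set α))) =
      Fintype.card ((s +ₛ stabilizer α (↑(s * t) : Set α)) *
        (t +ₛ stabilizer α (↑(s * t) : Set α))) := by
    simp_rw [h2]
    congr
  simp only [h1, h3, Fintype.card_coe] at temp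
  rw [temp]

/-- In a finite commutative group the stabilizer of a nonempty finset is (the underlying set of) a
subgroup, so its cardinality divides the order of the group (Lagrange).  Added for the STPP census,
which uses `|Stab(X + Y)| ∣ |G|`. [cite: Nathanson1996, §4.1] -/
@[to_additive /-- In a finite commutative (additive) group the stabilizer of a nonempty finset is a
subgroup, so its cardinality divides the order of the group (Lagrange). -/]
lemma Nonempty.card_mulStab_dvd_card_univ [Fintype α] (hs : s.Nonempty) :
    #s.mulStab ∣ Fintype.card α := by
  have h1 : s * univ = (univ : Finset α) := by
    refine eq_univ_of_forall fun x ↦ ?_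
    obtain ⟨a, ha⟩ := hs
    exact mem_mul.2 ⟨a, ha, a⁻¹ * x, mem_univ _, mul_inv_cancel_left a x⟩
  have h2 : (univ : Finset α).mulStab = univ :=
    eq_univ_of_forall fun x ↦ (mem_mulStab univ_nonempty).2 smul_finset_univ
  have h3 : s.mulStab ⊆ (univ : Finset α).mulStab := by
    simpa only [h1] using subset_mulStab_mul_left (s := s) (t := univ) univ_nonempty
  simpa only [h2, card_univ] using card_mulStab_dvd_card_mulStab hs h3

end Finset

/-! ## Part II — Kneser's theorem (DeVos's argument) -/

namespace Literature.Combinatorics.Additive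

open Finset

variable {α : Type*} [CommGroup α] [DecidableEq α] {s s' t t' C : Finset α} {a b : α}


/-! ### Auxiliary results -/

/-- DeVos's key step: with `H = C.mulStab`, if the coset `(a*b) • H` is not contained in `s * t` then the stabilizer of `(s ∩ a • H) * (t ∩ b • H)` is a PROPER subset of `H`. [cite: DeVos2014, proof of Thm 1] -/
@[to_additive]
private lemma mulStab_mul_ssubset_mulStab (hs₁ : (s ∩ a • C.mulStab).Nonempty)
    (ht₁ : (t ∩ b • C.mulStab).Nonempty) (hab : ¬(a * b) • C.mulStab ⊆ s * t) :
    (s ∩ a • C.mulStab * (t ∩ b • C.mulStab)).mulStab ⊂ C.mulStab := by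
  have hCne : C.Nonempty := by
    contrapose! hab
    simp only [hab, mulStab_empty, smul_finset_empty, empty_subset]
  obtain ⟨x, hx⟩ := hs₁
  obtain ⟨y, hy⟩ := ht₁
  obtain ⟨c, hc, hac⟩ := mem_smul_finset.mp (mem_of_mem_inter_right hx)
  obtain ⟨d, hd, had⟩ := mem_smul_finset.mp (mem_of_mem_inter_right hy)
  have hsubset : (s ∩ a • C.mulStab * (t ∩ b • C.mulStab)).mulStab ⊆ C.mulStab := by
    have hxymem : x * y ∈ s ∩ a • C.mulStab * (t ∩ b • C.mulStab) := mul_mem_mul hx hy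
    apply subset_trans (mulStab_subset_div_right hxymem)
    have : s ∩ a • C.mulStab * (t ∩ b • C.mulStab) ⊆ (x * y) • C.mulStab := by
      apply subset_trans (mul_subset_mul inter_subset_right inter_subset_right)
      rw [smul_mul_smul_comm]
      rw [← hac, ← had, smul_mul_smul_comm, smul_assoc]
      apply smul_finset_subset_smul_finset
      rw [← smul_smul]
      rw [mul_subset_iff]
      intro x hx y hy
      rw [smul_mulStab hd, smul_mulStab hc, mem_mulStab hCne, ← smul_smul,
        (mem_mulStab hCne).mp hy, (mem_mulStab hCne).mp hx]
    apply subset_trans (div_subset_div_right this) _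
    simp [singleton_mul, div_eq_inv_mul, smul_smul, mul_assoc]
  have : (a * b) • C.mulStab = (a * c * (b * d)) • C.mulStab := by
    rw [smul_eq_iff_eq_inv_smul, ← smul_assoc, smul_eq_mul, mul_assoc, mul_comm c _, ← mul_assoc, ←
      mul_assoc, ← mul_assoc, mul_assoc _ a b, inv_mul_cancel (a * b), one_mul, ← smul_eq_mul,
      smul_assoc, smul_mulStab hc, smul_mulStab hd]
  have hsub : s ∩ a • C.mulStab * (t ∩ b • C.mulStab) ⊆ (a * b) • C.mulStab := by
    apply subset_trans (mul_subset_mul inter_subset_right inter_subset_right)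
    simp only [smul_mul_smul_comm, mulStab_mul_mulStab, subset_refl]
  have hxy : x * y ∈ s ∩ a • C.mulStab * (t ∩ b • C.mulStab) := mul_mem_mul hx hy
  rw [this] at hsub
  rw [this] at hab
  obtain ⟨z, hz, hzst⟩ := not_subset.1 hab
  obtain ⟨w, hw, hwz⟩ := mem_smul_finset.mp hz
  refine (Finset.ssubset_iff_of_subset hsubset).mpr ⟨w, hw, ?_⟩
  rw [mem_mulStab' ⟨x * y, hxy⟩]
  push Not
  refine ⟨a * c * (b * d), by simp_all, ?_⟩
  rw [smul_eq_mul, mul_comm w, ← smul_eq_mul (b := w), hwz]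
  exact notMem_mono (mul_subset_mul inter_subset_left inter_subset_left) hzst

/-- With `H = C.mulStab` and `C` disjoint from `(s ∩ a • H) * (t ∩ b • H)`: the stabilizer of `C ∪ (s ∩ a • H) * (t ∩ b • H)` equals that of `(s ∩ a • H) * (t ∩ b • H)` (DeVos: `S(C_i) = H_i`). [cite: DeVos2014, proof of Thm 1] -/
@[to_additive]
private lemma mulStab_union (hs₁ : (s ∩ a • C.mulStab).Nonempty) (ht₁ : (t ∩ b • C.mulStab).Nonempty)
    (hab : ¬(a * b) • C.mulStab ⊆ s * t)
    (hC : Disjoint C (s ∩ a • C.mulStab * (t ∩ b • C.mulStab))) :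
    (C ∪ s ∩ a • C.mulStab * (t ∩ b • C.mulStab)).mulStab =
      (s ∩ a • C.mulStab * (t ∩ b • C.mulStab)).mulStab := by
  obtain rfl | hCne := C.eq_empty_or_nonempty
  · simp
  refine
    ((subset_inter (mulStab_mul_ssubset_mulStab hs₁ ht₁ hab).subset Subset.rfl).trans
          inter_mulStab_subset_mulStab_union).antisymm'
      fun x hx => ?_
  replace hx := (mem_mulStab <| (hs₁.mul ht₁).mono subset_union_right).mp hx
  rw [smul_finset_union] at hx
  suffices hxC : x ∈ C.mulStab by
    rw [(mem_mulStab hCne).mp hxC] at hx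
    rw [mem_mulStab_iff_subset_smul_finset (hs₁.mul ht₁)]
    exact hC.symm.left_le_of_le_sup_left (le_sup_right.trans hx.ge)
  rw [mem_mulStab_iff_smul_finset_subset hCne]
  obtain h | h := disjoint_or_nonempty_inter (x • C) (s ∩ a • C.mulStab * (t ∩ b • C.mulStab))
  · exact h.left_le_of_le_sup_right (le_sup_left.trans_eq hx)
  have hUn :
    ((C.biUnion fun y => x • y • C.mulStab) ∩
        (s ∩ a • C.mulStab * (t ∩ b • C.mulStab))).Nonempty := by
    have : (x • C.biUnion fun y => y • C.mulStab) = C.biUnion fun y => x • y • C.mulStab :=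
      biUnion_image
    simpa [← this]
  simp_rw [biUnion_inter, biUnion_nonempty, ← smul_assoc, smul_eq_mul] at hUn
  obtain ⟨y, hy, hyne⟩ := hUn
  have hxyCsubC : (x * y) • C.mulStab ⊆ x • C := by
    rw [← smul_eq_mul, smul_assoc, smul_finset_subset_smul_finset_iff]
    exact smul_finset_mulStab_subset hy
  have hxyC : Disjoint ((x * y) • C.mulStab) C := by
    convert disjoint_smul_finset_mulStab_mul_mulStab fun hxyC => _
    · exact C.mul_mulStab.symm
    rw [mul_mulStab] at hxyC
    exact hyne.not_disjoint (hC.mono_left hxyC)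
  have hxysub : (x * y) • C.mulStab ⊆ s ∩ a • C.mulStab * (t ∩ b • C.mulStab) :=
    hxyC.left_le_of_le_sup_left (hxyCsubC.trans <| subset_union_left.trans hx.subset)
  suffices s ∩ a • C.mulStab * (t ∩ b • C.mulStab) ⊂ (a * b) • C.mulStab by
    have := (card_le_card hxysub).not_gt ((card_lt_card this).trans_eq ?_)
    cases this
    simp_rw [card_smul_finset]
  apply ssubset_of_subset_not_subset
  · refine (mul_subset_mul inter_subset_right inter_subset_right).trans ?_
    simp only [smul_mul_smul_comm, mulStab_mul_mulStab, subset_refl]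
  · contrapose! hab
    exact hab.trans (mul_subset_mul inter_subset_left inter_subset_left)

/-- DeVos's inequality (1): `|(s ∪ t)H| − |(s ∪ t)H'| < |H| − |s'H'| − |t'H'|` from non-convergence of `C ∪ s't'` and the induction hypothesis. [cite: DeVos2014, proof of Thm 1, (1)] -/
@[to_additive]
private lemma mul_aux1
    (ih : #(s' * (s' * t').mulStab) + #(t' * (s' * t').mulStab) ≤ #(s' * t') + #(s' * t').mulStab)
    (hconv : #(s ∩ t) + #((s ∪ t) * C.mulStab) ≤ #C + #C.mulStab)
    (hnotconv :
      #(C ∪ s' * t') + #(C ∪ s' * t').mulStab < #(s ∩ t) + #((s ∪ t) * (C ∪ s' * t').mulStab))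
    (hCun : (C ∪ s' * t').mulStab = (s' * t').mulStab) (hdisj : Disjoint C (s' * t')) :
    (#((s ∪ t) * C.mulStab) - #((s ∪ t) * (s' * t').mulStab) : ℤ) <
      #C.mulStab - #(s' * (s' * t').mulStab) - #(t' * (s' * t').mulStab) := by
  set H := C.mulStab
  set H' := (s' * t').mulStab
  set C' := C ∪ s' * t'
  zify at hconv hnotconv ih
  calc
    (#((s ∪ t) * H) - #((s ∪ t) * H') : ℤ) < #C + #H - #(s ∩ t) - (#C' + #H' - #(s ∩ t)) := by
      rw [← hCun]
      linarith [hconv, hnotconv]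
    _ = #H - #(s' * t') - #H' := by
      rw [card_union_of_disjoint hdisj, Int.natCast_add]
      abel
    _ ≤ #H - #(s' * H') - #(t' * H') := by linarith [ih]

/-- If `s ⊆ t` and the coset `a • s.mulStab` is not contained in `t`, then it is disjoint from `s`. [cite: DeVos2014, proof of Thm 1] -/
@[to_additive]
private lemma disjoint_smul_mulStab (hst : s ⊆ t) (has : ¬a • s.mulStab ⊆ t) :
    Disjoint s (a • s.mulStab) := by
  suffices Disjoint (a • s.mulStab) (s * s.mulStab) by
    simpa [mul_comm, disjoint_comm, mulStab_mul]
  apply disjoint_smul_finset_mulStab_mul_mulStab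
  rw [mul_comm, mulStab_mul]
  contrapose! has
  exact subset_trans has hst

/-- DeVos's count when `B₂ = ∅`: `|H| − |s₁ H₁| ≤ |(s ∪ t)H| − |(s ∪ t)H₁|` (the coset `a • H` minus `s₁ H₁`). [cite: DeVos2014, proof of Thm 1] -/
@[to_additive]
private lemma disjoint_mul_sub_card_le {a : α} (b : α) {s t C : Finset α} (has : a ∈ s)
    (hsC : Disjoint t (a • C.mulStab))
    (hst : (s ∩ a • C.mulStab * (t ∩ b • C.mulStab)).mulStab ⊆ C.mulStab) :
    (#C.mulStab : ℤ) -
        #(s ∩ a • C.mulStab * (s ∩ a • C.mulStab * (t ∩ b • C.mulStab)).mulStab) ≤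
      #((s ∪ t) * C.mulStab) -
        #((s ∪ t) * (s ∩ a • C.mulStab * (t ∩ b • C.mulStab)).mulStab) := by
  obtain rfl | hC := C.eq_empty_or_nonempty
  · simp
  calc
    (#C.mulStab : ℤ) -
          #(s ∩ a • C.mulStab * (s ∩ a • C.mulStab * (t ∩ b • C.mulStab)).mulStab) =
        #(a • C.mulStab \
            (s ∩ a • C.mulStab * (s ∩ a • C.mulStab * (t ∩ b • C.mulStab)).mulStab)) := by
      rw [card_sdiff_of_subset
          (subset_trans (mul_subset_mul_left hst)
            (subset_trans (mul_subset_mul_right inter_subset_right) _)),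
        card_smul_finset, Int.ofNat_sub]
      · apply le_trans (card_le_card (mul_subset_mul_left hst))
        apply
          le_trans (card_le_card inter_mul_subset)
            (le_of_le_of_eq (card_le_card inter_subset_right) _)
        rw [smul_mul_assoc, mulStab_mul_mulStab, card_smul_finset]
      · simp only [smul_mul_assoc, mulStab_mul_mulStab, Subset.rfl]
    _ ≤ #((s ∪ t) * C.mulStab) -
          #((s ∪ t) * (s ∩ a • C.mulStab * (t ∩ b • C.mulStab)).mulStab) := by
      rw [← Int.ofNat_sub (card_le_card (mul_subset_mul_left hst)),
        ← card_sdiff_of_subset (mul_subset_mul_left hst)]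
      norm_cast
      gcongr #?_
      refine fun x hx => mem_sdiff.mpr ⟨?_, ?_⟩
      · apply smul_finset_subset_smul (mem_union_left t has) (mem_sdiff.mp hx).1
      have hx' := (mem_sdiff.mp hx).2
      contrapose! hx'
      obtain ⟨y, hyst, d, hd, hxyd⟩ := mem_mul.mp hx'
      obtain ⟨c, hc, hcx⟩ := mem_smul_finset.mp (mem_sdiff.mp hx).1
      rw [← hcx, ← eq_mul_inv_iff_mul_eq] at hxyd
      have hyC : y ∈ a • C.mulStab := by
        rw [hxyd, smul_mul_assoc, smul_mem_smul_finset_iff, ← mulStab_mul_mulStab]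
        apply mul_mem_mul hc ((mem_mulStab hC).mpr (inv_smul_eq_iff.mpr _))
        exact Eq.symm ((mem_mulStab hC).mp (hst hd))
      replace hyst : y ∈ s := by
        apply or_iff_not_imp_right.mp (mem_union.mp hyst)
        contrapose! hsC
        exact not_disjoint_iff.mpr ⟨y, hsC, hyC⟩
      rw [eq_mul_inv_iff_mul_eq, hcx] at hxyd
      rw [← hxyd]
      exact mul_mem_mul (mem_inter.mpr ⟨hyst, hyC⟩) hd

/-- DeVos's count when `a + H = b + H`: `|H| − |s₁H₁| − |t₁H₁| ≤ |(s ∪ t)H| − |(s ∪ t)H₁|`. [cite: DeVos2014, proof of Thm 1] -/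
@[to_additive]
private lemma inter_mul_sub_card_le {a : α} {s t C : Finset α} (has : a ∈ s)
    (hst : (s ∩ a • C.mulStab * (t ∩ a • C.mulStab)).mulStab ⊆ C.mulStab) :
    (#C.mulStab : ℤ) -
          #(s ∩ a • C.mulStab * (s ∩ a • C.mulStab * (t ∩ a • C.mulStab)).mulStab) -
        #(t ∩ a • C.mulStab * (s ∩ a • C.mulStab * (t ∩ a • C.mulStab)).mulStab) ≤
      #((s ∪ t) * C.mulStab) -
        #((s ∪ t) * (s ∩ a • C.mulStab * (t ∩ a • C.mulStab)).mulStab) := by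
  obtain rfl | hC := C.eq_empty_or_nonempty
  · simp
  calc
    (#C.mulStab : ℤ) -
            #(s ∩ a • C.mulStab * (s ∩ a • C.mulStab * (t ∩ a • C.mulStab)).mulStab) -
          #(t ∩ a • C.mulStab * (s ∩ a • C.mulStab * (t ∩ a • C.mulStab)).mulStab) ≤
        #(a • C.mulStab \
            ((s ∩ a • C.mulStab ∪ t ∩ a • C.mulStab) *
              (s ∩ a • C.mulStab * (t ∩ a • C.mulStab)).mulStab)) := by
      rw [card_sdiff_of_subset, Int.ofNat_sub (card_le_card _), card_smul_finset]
      · grw [union_mul, le_sub_iff_add_le, card_union_le]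
        norm_num
      all_goals
        apply subset_trans (mul_subset_mul_left hst)
        rw [← union_inter_distrib_right]
        refine subset_trans (mul_subset_mul_right inter_subset_right) ?_
        simp only [smul_mul_assoc, mulStab_mul_mulStab, Subset.rfl]
    _ ≤ #((s ∪ t) * C.mulStab) -
          #((s ∪ t) * (s ∩ a • C.mulStab * (t ∩ a • C.mulStab)).mulStab) := by
      rw [← Int.ofNat_sub (card_le_card (mul_subset_mul_left hst)),
        ← card_sdiff_of_subset (mul_subset_mul_left hst)]
      norm_cast
      apply card_le_card
      refine fun x hx => mem_sdiff.mpr ⟨?_, ?_⟩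
      · apply smul_finset_subset_smul (mem_union_left t has) (mem_sdiff.mp hx).1
      have hx' := (mem_sdiff.mp hx).2
      contrapose! hx'
      rw [← union_inter_distrib_right]
      obtain ⟨y, hyst, d, hd, hxyd⟩ := mem_mul.mp hx'
      obtain ⟨c, hc, hcx⟩ := mem_smul_finset.mp (mem_sdiff.mp hx).1
      rw [← hcx, ← eq_mul_inv_iff_mul_eq] at hxyd
      have hyC : y ∈ a • C.mulStab := by
        rw [hxyd, smul_mul_assoc, smul_mem_smul_finset_iff, ← mulStab_mul_mulStab]
        apply mul_mem_mul hc ((mem_mulStab hC).mpr (inv_smul_eq_iff.mpr _))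
        exact Eq.symm ((mem_mulStab hC).mp (hst hd))
      rw [eq_mul_inv_iff_mul_eq, hcx] at hxyd
      rw [← hxyd]
      exact mul_mem_mul (mem_inter.mpr ⟨hyst, hyC⟩) hd

/-- The induction measure `|s't'| + |s'|` drops for `s' ⊆ s`, `t' ⊆ t` when a nonempty `C ⊆ s*t` avoids `s'*t'`. [cite: DeVos2014, proof of Thm 1] -/
@[to_additive]
private lemma card_mul_add_card_lt (hC : C.Nonempty) (hs : s' ⊆ s) (ht : t' ⊆ t)
    (hCst : C ⊆ s * t) (hCst' : Disjoint C (s' * t')) :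
    #(s' * t') + #s' < #(s * t) + #s :=
  add_lt_add_of_lt_of_le
      (by
        rw [← tsub_pos_iff_lt, ← card_sdiff_of_subset (mul_subset_mul hs ht), card_pos]
        exact hC.mono (subset_sdiff.2 ⟨hCst, hCst'⟩)) <|
    card_le_card hs

/-! ### Kneser's theorem -/

variable (s t)

/-- **Kneser's theorem** (multiplicative form; commutative group).  For finite `s, t` and
`H := (s * t).mulStab` the stabilizer of the product set: `#(s * H) + #(t * H) ≤ #(s * t) + #H`, i.e.
`|AB| ≥ |AH| + |BH| − |H|` — verbatim [DeVos 2014, Thm 1] (= Kneser 1953; Nathanson GTM 165 Thm 4.3;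
Tao–Vu Thm 5.5), written additively there.  Proof: DeVos's intersection–union argument, by strong
induction on `#(s * t) + #s` generalising the group (quotient by the stabilizer when it is
non-trivial; then convergents `C ⊆ s * t` with `#(s ∩ t) + #((s ∪ t) * C.mulStab) ≤ #C + #C.mulStab`,
one with minimal stabilizer, and the final double counting over the two cosets `a • H ≠ b • H`).
[cite: DeVos2014, Thm 1] -/
@[to_additive /-- **Kneser's addition theorem** (commutative group).  For finite `s, t` and
`H := (s + t).addStab` the stabilizer of the sumset: `#(s + H) + #(t + H) ≤ #(s + t) + #H`, i.e.
`|A + B| ≥ |A + H| + |B + H| − |H|` (Kneser 1953; DeVos 2014 Thm 1; Nathanson GTM 165 Thm 4.3;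
Tao–Vu Thm 5.5). -/]
theorem mul_kneser :
    #(s * (s * t).mulStab) + #(t * (s * t).mulStab)
      ≤ #(s * t) + #(s * t).mulStab := by
  -- We're doing induction on `#(s * t) + #s` generalizing the group. This is a bit tricky
  -- in Lean.
  set n : ℕ := #(s * t) + #s with hn
  clear_value n
  induction n using Nat.strong_induction_on generalizing α with | h n ih =>
  subst hn
  -- The cases `s = ∅` and `t = ∅` are easily taken care of.
  obtain rfl | hs := s.eq_empty_or_nonempty
  · simp
  obtain rfl | ht := t.eq_empty_or_nonempty
  · simp
  classical
  -- We distinguish whether `s * t` has trivial stabilizer.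
  obtain hstab | hstab := ne_or_eq (s * t).mulStab 1
  · have image_coe_mul :
      ((s * t).image (↑) : Finset (α ⧸ stabilizer α (↑(s * t) : Set α))) =
        s.image (↑) * t.image (↑) :=
      image_mul (QuotientGroup.mk' _ : α →* α ⧸ stabilizer α (↑(s * t) : Set α))
    suffices hineq :
      #(s * t).mulStab *
          (#(s.image (↑) : Finset (α ⧸ stabilizer α (↑(s * t) : Set α))) +
              #(t.image (↑) : Finset (α ⧸ stabilizer α (↑(s * t) : Set α))) -  1) ≤
        #(s * t) by
    -- now to prove that `#(s * (s * t).mulStab) = #(s * t).mulStab * #(s.image (↑))` and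
    -- the analogous statement for `s` and `t` interchanged
    -- this will conclude the proof of the first case immediately
      rw [mul_tsub, mul_one, mul_add, tsub_le_iff_left, card_mulStab_mul_card_image_coe',
        card_mulStab_mul_card_image_coe'] at hineq
      convert! hineq using 1
      exact add_comm _ _
    refine le_of_le_of_eq (mul_le_mul_right ?_ _) (card_mul_card_eq_mulStab_card_mul_coe s t).symm
    have := ih _ ?_ (s.image (↑) : Finset (α ⧸ stabilizer α (↑(s * t) : Set α))) (t.image (↑)) rfl
    · classical
      simpa only [← image_coe_mul, mulStab_image_coe_quotient (hs.mul ht), mul_one,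
        tsub_le_iff_right, card_one] using this
    rw [← image_coe_mul, card_mul_card_eq_mulStab_card_mul_coe]
    exact
      add_lt_add_of_lt_of_le
        (lt_mul_left ((hs.mul ht).image _).card_pos <|
          Finset.one_lt_card.2 ((hs.mul ht).mulStab_nontrivial.2 hstab))
        card_image_le
  -- Simplify the induction hypothesis a bit. We will only need it over `α` from now on.
  simp only [hstab, mul_one, card_one] at ih ⊢
  replace ih := fun s' t' h => @ih _ h α _ _ s' t' rfl
  obtain ⟨a, rfl⟩ | ⟨a, ha, b, hb, hab⟩ := hs.exists_eq_singleton_or_nontrivial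
  · rw [card_singleton, card_singleton_mul, add_comm]
  have : b / a ∉ t.mulStab := by
    refine fun h => hab (Eq.symm (eq_of_div_eq_one ?_))
    replace h := subset_mulStab_mul_right hs h
    rw [hstab, mem_one] at h
    exact h
  simp only [mem_mulStab' ht, smul_eq_mul, Classical.not_forall, exists_prop] at this
  obtain ⟨c, hc, hbac⟩ := this
  set t' := (a / c) • t with ht'
  clear_value t'
  rw [← inv_smul_eq_iff] at ht'
  subst ht'
  rename' t' => t
  rw [mem_inv_smul_finset_iff, smul_eq_mul, div_mul_cancel] at hc
  rw [div_mul_comm, mem_inv_smul_finset_iff, smul_eq_mul, ← mul_assoc, div_mul_div_cancel',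
    div_self', one_mul] at hbac
  rw [smul_finset_nonempty] at ht
  simp only [mul_smul_comm, mulStab_smul, card_smul_finset] at *
  have hst : (s ∩ t).Nonempty := ⟨_, mem_inter.2 ⟨ha, hc⟩⟩
  have hsts : s ∩ t ⊂ s :=
    ⟨inter_subset_left, not_subset.2 ⟨_, hb, fun h => hbac <| inter_subset_right h⟩⟩
  clear! a b
  set convergent : Set (Finset α) :=
    {C | C ⊆ s * t ∧ #(s ∩ t) + #((s ∪ t) * C.mulStab) ≤ #C + #C.mulStab}
  have convergent_nonempty : convergent.Nonempty := by
    refine ⟨s ∩ t * (s ∪ t), inter_mul_union_subset, (add_le_add_left (card_le_card <|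
      subset_mul_left _ <| one_mem_mulStab.2 <| hst.mul <| hs.mono subset_union_left) _).trans <|
        ih (s ∩ t) (s ∪ t) ?_⟩
    exact add_lt_add_of_le_of_lt (card_le_card inter_mul_union_subset) (card_lt_card hsts)
  let C := argminOn (fun C : Finset α => #C.mulStab) _ convergent_nonempty
  set H := C.mulStab with hH
  obtain ⟨hCst, hCcard⟩ : C ∈ convergent := argminOn_mem _ _ _
  have hCmin (D : Finset α) (hDH : D.mulStab ⊂ H) : D ∉ convergent := fun hD ↦
    (card_lt_card hDH).not_ge <| argminOn_le (fun D : Finset α => #D.mulStab) _ hD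
  clear_value C
  clear convergent_nonempty
  obtain rfl | hC := C.eq_empty_or_nonempty
  · simp [hst.ne_empty] at hCcard
  -- If the stabilizer of `C` is trivial, then
  -- `#s + #t - 1 = #(s ∩ t) + #(s ∪ t) - 1 = ≤ #C ≤ #(s * t)`
  obtain hCstab | hCstab := eq_singleton_or_nontrivial (one_mem_mulStab.2 hC)
  · simp only [hCstab, card_singleton, card_mul_singleton, card_inter_add_card_union] at hCcard
    grw [hCcard, hCst]
  exfalso
  have : ¬s * t * H ⊆ s * t := by
    rw [mul_subset_left_iff (hs.mul ht), hstab, ← coe_subset, coe_one]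
    exact hCstab.coe.not_subset_singleton
  simp_rw [mul_subset_iff_left, Classical.not_forall, mem_mul] at this
  obtain ⟨_, ⟨a, ha, b, hb, rfl⟩, hab⟩ := this
  set s₁ := s ∩ a • H with hs₁
  set s₂ := s ∩ b • H with hs₂
  set t₁ := t ∩ b • H with ht₁
  set t₂ := t ∩ a • H with ht₂
  have hs₁s : s₁ ⊆ s := inter_subset_left
  have hs₂s : s₂ ⊆ s := inter_subset_left
  have ht₁t : t₁ ⊆ t := inter_subset_left
  have ht₂t : t₂ ⊆ t := inter_subset_left
  have has₁ : a ∈ s₁ := mem_inter.mpr ⟨ha, mem_smul_finset.2 ⟨1, one_mem_mulStab.2 hC, mul_one _⟩⟩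
  have hbt₁ : b ∈ t₁ := mem_inter.mpr ⟨hb, mem_smul_finset.2 ⟨1, one_mem_mulStab.2 hC, mul_one _⟩⟩
  have hs₁ne : s₁.Nonempty := ⟨_, has₁⟩
  have ht₁ne : t₁.Nonempty := ⟨_, hbt₁⟩
  set C₁ := C ∪ s₁ * t₁
  set C₂ := C ∪ s₂ * t₂
  set H₁ := (s₁ * t₁).mulStab with hH₁
  set H₂ := (s₂ * t₂).mulStab
  have hC₁st : C₁ ⊆ s * t := union_subset hCst (mul_subset_mul hs₁s ht₁t)
  have hC₂st : C₂ ⊆ s * t := union_subset hCst (mul_subset_mul hs₂s ht₂t)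
  have hstabH₁ : s₁ * t₁ ⊆ (a * b) • H := by
    rw [hH, ← mulStab_mul_mulStab C, ← smul_mul_smul_comm]
    apply mul_subset_mul inter_subset_right inter_subset_right
  have hstabH₂ : s₂ * t₂ ⊆ (a * b) • H := by
    rw [hH, ← mulStab_mul_mulStab C, ← smul_mul_smul_comm, mul_comm s₂ t₂]
    apply mul_subset_mul inter_subset_right inter_subset_right
  have hCst₁ := disjoint_of_subset_right hstabH₁ (disjoint_smul_mulStab hCst hab)
  have hCst₂ := disjoint_of_subset_right hstabH₂ (disjoint_smul_mulStab hCst hab)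
  have hst₁ : #(s₁ * t₁) + #s₁ < #(s * t) + #s :=
    card_mul_add_card_lt hC hs₁s ht₁t hCst hCst₁
  have hst₂ : #(s₂ * t₂) + #s₂ < #(s * t) + #s :=
    card_mul_add_card_lt hC hs₂s ht₂t hCst hCst₂
  have hC₁stab : C₁.mulStab = H₁ := mulStab_union hs₁ne ht₁ne hab hCst₁
  have hH₁H : H₁ ⊂ H := mulStab_mul_ssubset_mulStab hs₁ne ht₁ne hab
  have aux1₁ :=
    mul_aux1 (ih _ _ hst₁) hCcard
      (not_le.1 fun h => hCmin _ (hC₁stab.trans_ssubset hH₁H) ⟨hC₁st, h⟩) hC₁stab hCst₁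
  obtain ht₂ | ht₂ne := t₂.eq_empty_or_nonempty
  · have aux₁_contr :=
      disjoint_mul_sub_card_le b (hs₁s has₁) (disjoint_iff_inter_eq_empty.2 ht₂) hH₁H.subset
    linarith [aux1₁, aux₁_contr, Int.natCast_nonneg #(t₁ * (s₁ * t₁).mulStab)]
  obtain hs₂ | hs₂ne := s₂.eq_empty_or_nonempty
  · have aux1₁_contr :
      (#C.mulStab : ℤ) - #(t₁ * (s₁ * t₁).mulStab) ≤
        #((s ∪ t) * C.mulStab) - #((s ∪ t) * (s₁ * t₁).mulStab) := by
      simpa [union_comm, mul_comm s₁ t₁] using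
        disjoint_mul_sub_card_le a (ht₁t hbt₁) (disjoint_iff_inter_eq_empty.2 hs₂)
          (by rw [mul_comm]; exact hH₁H.subset)
    linarith [aux1₁, aux1₁_contr, Int.natCast_nonneg #(s₁ * (s₁ * t₁).mulStab)]
  have hC₂stab : C₂.mulStab = H₂ := mulStab_union hs₂ne ht₂ne (by rwa [mul_comm]) hCst₂
  have hH₂H : H₂ ⊂ H := mulStab_mul_ssubset_mulStab hs₂ne ht₂ne (by rwa [mul_comm])
  have aux1₂ :=
    mul_aux1 (ih _ _ hst₂) hCcard
      (not_le.1 fun h => hCmin _ (hC₂stab.trans_ssubset hH₂H) ⟨hC₂st, h⟩) hC₂stab hCst₂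
  obtain habH | habH := eq_or_ne (a • H) (b • H)
  · rw [hH₁, hs₁, ht₁, ← habH, hH] at hH₁H
    refine aux1₁.not_ge ?_
    simp only [hs₁, ht₁, ← habH, inter_mul_sub_card_le (hs₁s has₁) hH₁H.subset, H]
  -- temporarily skipping deduction of inequality (2)
  set S := a • H \ (s₁ ∪ t₂) with hS
  set T := b • H \ (s₂ ∪ t₁) with hT
  have hST : Disjoint S T :=
    (C.pairwiseDisjoint_smul_finset_mulStab (Set.mem_range_self _) (Set.mem_range_self _)
          habH).mono
      sdiff_le sdiff_le
  have hSst : S ⊆ a • H \ (s ∪ t) := by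
    simp only [hS, hs₁, ht₂, ← union_inter_distrib_right, sdiff_inter_self_right, Subset.rfl]
  have hTst : T ⊆ b • H \ (s ∪ t) := by
    simp only [hT, hs₂, ht₁, ← union_inter_distrib_right, sdiff_inter_self_right, Subset.rfl]
  have hSTst : Disjoint (S ∪ T) (s ∪ t) := (subset_sdiff.1 hSst).2.sup_left (subset_sdiff.1 hTst).2
  have hstconv : s * t ∉ convergent := by
    apply hCmin (s * t)
    rw [hstab]
    refine (hC.mulStab_nontrivial.mp hCstab).symm.ssubset_of_subset ?_
    simp only [one_subset, one_mem_mulStab, hC]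
  simp only [Set.mem_setOf_eq, Subset.rfl, true_and, not_le, hstab, mul_one, card_one,
    convergent] at hstconv
  zify at hstconv
  have hSTcard : (#S : ℤ) + #T + #(s ∪ t) ≤ #((s ∪ t) * H) := by
    norm_cast
    conv_lhs => rw [← card_union_of_disjoint hST, ← card_union_of_disjoint hSTst, ← mul_one (s ∪ t)]
    refine card_le_card
      (union_subset (union_subset ?_ ?_) <| mul_subset_mul_left <| one_subset.2 hC.one_mem_mulStab)
    · exact hSst.trans (sdiff_subset.trans <| smul_finset_subset_smul <| mem_union_left _ ha)
    · exact hTst.trans (sdiff_subset.trans <| smul_finset_subset_smul <| mem_union_right _ hb)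
  have hH₁ne : H₁.Nonempty := (hs₁ne.mul ht₁ne).mulStab
  have hH₂ne : H₂.Nonempty := (hs₂ne.mul ht₂ne).mulStab
  -- Now we prove inequality (2)
  have aux2₁ : (#s₁ : ℤ) + #t₁ + #H₁ ≤ #H := by
    rw [← le_sub_iff_add_le']
    refine (Int.le_of_dvd ((sub_nonneg_of_le <| Nat.cast_le.2 <| card_le_card <|
      mul_subset_mul_left hH₁H.subset).trans_lt aux1₁) <| dvd_sub
        (dvd_sub (card_mulStab_dvd_card_mulStab (hs₁ne.mul ht₁ne) hH₁H.subset).natCast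
          (card_mulStab_dvd_card_mul_mulStab _ _).natCast) <|
        (card_mulStab_dvd_card_mul_mulStab _ _).natCast).trans ?_
    rw [sub_sub]
    gcongr _ - (Nat.cast ?_ + Nat.cast ?_) <;> exact card_le_card_mul_right hH₁ne
  have aux2₂ : (#s₂ : ℤ) + #t₂ + #H₂ ≤ #H := by
    rw [← le_sub_iff_add_le']
    refine (Int.le_of_dvd ((sub_nonneg_of_le <| Nat.cast_le.2 <| card_le_card <|
      mul_subset_mul_left hH₂H.subset).trans_lt aux1₂) <| dvd_sub
        (dvd_sub (card_mulStab_dvd_card_mulStab (hs₂ne.mul ht₂ne) hH₂H.subset).natCast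
          (card_mulStab_dvd_card_mul_mulStab _ _).natCast) <|
        (card_mulStab_dvd_card_mul_mulStab _ _).natCast).trans ?_
    rw [sub_sub]
    exact sub_le_sub_left (add_le_add (Nat.cast_le.2 <| card_le_card_mul_right hH₂ne) <|
      Nat.cast_le.2 <| card_le_card_mul_right hH₂ne) _
  -- Now we deduce inequality (3) using the above lemma in addition to the facts that `s * t` is not
  -- convergent and then induction hypothesis applied to `sᵢ` and `tᵢ`
  have aux3₁ : (#S : ℤ) + #T + #s₁ + #t₁ - #H₁ < #H :=
    calc
      (#S : ℤ) + #T + #s₁ + #t₁ - #H₁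
        < #S + #T + #(s ∪ t) + #(s ∩ t) - #(s * t) + #(s₁ * t₁) := by
        have ih₁ :=
          (add_le_add (card_le_card_mul_right hH₁ne) <| card_le_card_mul_right hH₁ne).trans
            (ih _ _ hst₁)
        zify at ih₁
        linarith [hstconv, ih₁]
      _ ≤ #((s ∪ t) * H) + #(s ∩ t) - #C := by
        suffices (#C : ℤ) + #(s₁ * t₁) ≤ #(s * t) by linarith [this, hSTcard]
        · norm_cast
          simpa only [← card_union_of_disjoint hCst₁] using card_le_card hC₁st
      _ ≤ #H := by
        simpa only [sub_le_iff_le_add, ← Int.natCast_add, Int.ofNat_le, add_comm _ #C,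
          add_comm _ #(s ∩ t)] using hCcard
  have aux3₂ : (#S : ℤ) + #T + #s₂ + #t₂ - #H₂ < #H :=
    calc
      (#S : ℤ) + #T + #s₂ + #t₂ - #H₂
       < #S + #T + #(s ∪ t) + #(s ∩ t) - #(s * t) + #(s₂ * t₂) := by
        have ih₂ :=
          (add_le_add (card_le_card_mul_right hH₂ne) <| card_le_card_mul_right hH₂ne).trans
            (ih _ _ hst₂)
        zify at hstconv ih₂
        linarith [ih₂]
      _ ≤ #((s ∪ t) * H) + #(s ∩ t) - #C := by
        suffices (#C : ℤ) + #(s₂ * t₂) ≤ #(s * t) by linarith [this, hSTcard]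
        · norm_cast
          simpa only [← card_union_of_disjoint hCst₂] using card_le_card hC₂st
      _ ≤ #H := by
        simpa only [sub_le_iff_le_add, ← Int.natCast_add, Int.ofNat_le, add_comm _ #C,
          add_comm _ #(s ∩ t)] using hCcard
  have aux4₁ : #H ≤ #S + (#s₁ + #t₂) := by
    grw [← card_smul_finset a H, card_le_card_sdiff_add_card, card_union_le]
  have aux4₂ : #H ≤ #T + (#s₂ + #t₁) := by
    grw [← card_smul_finset b H, card_le_card_sdiff_add_card, card_union_le]
  linarith [aux2₁, aux2₂, aux3₁, aux3₂, aux4₁, aux4₂]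

/-- The strict version of **Kneser's theorem**: if `#(s * H) + #(t * H) < #(s * t) + #H`
(`H = (s * t).mulStab`) then in fact `#(s * H) + #(t * H) ≤ #(s * t)`, because all three product sets
are unions of `H`-cosets, so a strict inequality between multiples of `#H` improves by `#H`
— Nathanson's dichotomy "either `|A + B| ≥ |A + H| + |B + H|` or `|A + B| = |A + H| + |B + H| − |H|`"
(GTM 165, proof of Thm 4.3, from Thm 4.2 applied to `A + H`, `B + H`). [cite: Nathanson1996, Thm 4.3 (proof)] -/
@[to_additive /-- The strict version of **Kneser's addition theorem**: if
`#(s + H) + #(t + H) < #(s + t) + #H` (`H = (s + t).addStab`) then `#(s + H) + #(t + H) ≤ #(s + t)`,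
all three sumsets being unions of `H`-cosets. -/]
lemma mul_strict_kneser (h : #(s * (s * t).mulStab) + #(t * (s * t).mulStab) <
      #(s * t) + #(s * t).mulStab) :
    #(s * (s * t).mulStab) + #(t * (s * t).mulStab) ≤ #(s * t) :=
  Nat.le_of_lt_add_of_dvd h
      ((card_mulStab_dvd_card_mul_mulStab _ _).add <| card_mulStab_dvd_card_mul_mulStab _ _) <|
    card_mulStab_dvd_card _

/-! ### Corollaries in the shape used by the STPP census -/

/-- **Kneser's theorem, weak form.**  For nonempty finite `s, t` in a commutative group:
`#s + #t ≤ #(s * t) + #(s * t).mulStab`, i.e. `|AB| ≥ |A| + |B| − |H|` with `H` the stabilizer of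
`AB` (the second inequality of Tao–Vu's statement). [cite: TaoVu2006, Thm 5.5] -/
@[to_additive /-- **Kneser's addition theorem, weak form.**  For nonempty finite `s, t` in a
commutative (additive) group: `#s + #t ≤ #(s + t) + #(s + t).addStab`, i.e.
`|A + B| ≥ |A| + |B| − |H|` with `H` the stabilizer of `A + B` (Tao–Vu, Thm 5.5). -/]
theorem card_add_card_le_card_mul_add_card_mulStab (hs : s.Nonempty) (ht : t.Nonempty) :
    #s + #t ≤ #(s * t) + #(s * t).mulStab := by
  have hH : (s * t).mulStab.Nonempty := (hs.mul ht).mulStab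
  calc #s + #t ≤ #(s * (s * t).mulStab) + #(t * (s * t).mulStab) :=
        add_le_add (card_le_card_mul_right hH) (card_le_card_mul_right hH)
    _ ≤ #(s * t) + #(s * t).mulStab := mul_kneser s t

/-- **Kneser's theorem, weak form with the group order.**  In a FINITE commutative group, for
nonempty `s, t`: `#s + #t ≤ #(s * t) + #H` where `H = (s * t).mulStab` and `#H ∣ Fintype.card α`
(the form in which the STPP census applies it: the period group is a subgroup, so its order is a
divisor of `|G|`). [cite: TaoVu2006, Thm 5.5] -/
@[to_additive /-- **Kneser's addition theorem, weak form with the group order.**  In a FINITE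
commutative (additive) group, for nonempty `s, t`: `#s + #t ≤ #(s + t) + #H` where
`H = (s + t).addStab` and `#H ∣ Fintype.card α`. -/]
theorem card_add_card_le_card_mul_add_card_mulStab_and_dvd [Fintype α] (hs : s.Nonempty) (ht : t.Nonempty) :
    #s + #t ≤ #(s * t) + #(s * t).mulStab ∧ #(s * t).mulStab ∣ Fintype.card α :=
  ⟨card_add_card_le_card_mul_add_card_mulStab s t hs ht, (hs.mul ht).card_mulStab_dvd_card_univ⟩

end Literature.Combinatorics.Additive
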